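import Literature.Algebra.Homology.HeisenbergObstructionQuadratic
import HarnessLib

/-!
# Level structures on a Heisenberg datum and the "level connecting cochain" of a non-closed `1`-cochain
# (Morgan–Smith, *The Cassels–Tate pairing for finite Galois modules*, §5: theta groups and the Poonen–Stoll class)

Pure algebra, sequel of `HeisenbergObstructionCocycle` / `HeisenbergObstructionQuadratic` (same conventions:
`D : HeisenbergDatum G M A` describes a central extension `0 → A → V → M → 0` of `G`-groups with the section
`s(x) = (0, x)`, `V = D.Ext`, commutator form `e = D.commForm`, `conn ξ (σ,τ) = χ_σ(ξ_τ) + m(ξ_σ, σξ_τ)`).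

A **level structure** (`LevelStructure`) on `D` is a `G`-stable additive subgroup `M₀ ≤ M` together with a
function `λ : M → A` such that the modified section `t(x) = (λ x, x)` (`lift`) is, ON `M₀`, a
`G`-equivariant group homomorphism `M₀ → V` (axioms `m_add_lam`, `χ_add_lam`).  In the language of
Morgan–Smith (Def. 5.7) this is a homomorphic equivariant section `s : M₁ → 𝓗₁` over the sub-object
`M₁ = M₀`, i.e. the datum of a VANISHING Poonen–Stoll class `ψ_PS = 0`; in particular `M₀` is isotropic for
`e` (`commForm_eq_zero`).

For a `1`-cochain `β : G → M` whose coboundary `dβ(σ,τ) = σβ_τ − β_{στ} + β_σ` (`cobd`) takes values in `M₀`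
(so that `β` is a cocycle modulo `M₀`), the **level connecting cochain** is

  `lconn β (σ,τ) := χ_σ(β_τ) + m(β_σ, σβ_τ) − m(dβ(σ,τ), β_{στ}) − λ(dβ(σ,τ))`,

the element of `A` defined by `s(β_σ) · σ s(β_τ) = inl(lconn β (σ,τ)) · t(dβ(σ,τ)) · s(β_{στ})` in `V`
(`sec_mul_act_sec_eq`; Morgan–Smith's `db − s ∘ A₁`).  PROVED:

* `lconn_cocycle` — **`d(lconn β) = −β ∪ₑ dβ`** in the tree's `2`-cocycle convention:
  `σ·c(τ,υ) + c(σ,τυ) + e(β_σ, σ dβ(τ,υ)) = c(στ,υ) + c(σ,τ)` (Morgan–Smith Lemma 5.12 with Lemma 5.15 for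
  `ψ_PS = 0`: `d(db − s∘A₁) = (f₂ a₂ − ψ_PS) ∪ A₁`);
* `lconn_add_of_isCrossedHom` — for a crossed homomorphism `κ` and an `M₀`-valued cochain `γ`,
  `lconn (κ + γ) = conn κ + e(γ_σ, σκ_τ) + e(κ_{στ}, dγ(σ,τ)) + ∂μ` with the explicit `1`-cochain
  `μ(σ) = −(λ(γ_σ) + m(κ_σ, γ_σ))` (Morgan–Smith Lemma 5.14 / Prop. 5.16 (2));
* `lconn_eq_conn` (a crossed homomorphism has `lconn = conn`), `cobd_cocycle` (`d ∘ d = 0`).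

These are the two cochain identities behind the alternation of the Cassels–Tate pairing in the presence of
a theta group with vanishing Poonen–Stoll class (Morgan–Smith Thm. 5.10); the arithmetic application (the
Cassels–Tate pairing of an elliptic curve at EVEN level) is NOT in this file.  Coboundaries are written in
the convention of the tree's `twoCocycleClass_eq_zero_iff` (`(∂b)(σ,τ) = σ b(τ) − b(στ) + b(σ)`).
References: A. Morgan, A. Smith, arXiv:2103.08530, §5 (Def. 5.1, 5.7, Lemmas 5.12, 5.14, 5.15, Prop. 5.16,
Thm. 5.10) [MorganSmith2021CTP]; J.-P. Serre, *Galois Cohomology* I §5.7 [SerreGaloisCohomology1997];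
K. S. Brown, *Cohomology of Groups* IV §3 [Brown1982].  Elementary algebra with complete proofs; no named
fact is introduced.
-/

set_option autoImplicit false

namespace Literature.Algebra.Homology

universe u v w

namespace HeisenbergDatum

variable {G : Type u} {M : Type v} {A : Type w} [Monoid G] [AddCommGroup M] [AddCommGroup A]
variable (D : HeisenbergDatum G M A)

/-! ### The coboundary of a `1`-cochain -/

/-- **The coboundary of a `1`-cochain** `β : G → M`: `dβ(σ,τ) = σβ_τ − β_{στ} + β_σ` (the convention of
the tree's `dOneCochain` / `contOneCocycles`). [cite: SerreGaloisCohomology1997, I §5.1 (cocycles, crossed homomorphisms)] -/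
def cobd (β : G → M) (g h : G) : M := D.ρ g (β h) - β (g * h) + β g

/-- Unfolding `cobd`. [cite: SerreGaloisCohomology1997, I §5.1 (cocycles, crossed homomorphisms)] -/
theorem cobd_apply (β : G → M) (g h : G) : D.cobd β g h = D.ρ g (β h) - β (g * h) + β g := rfl

/-- A crossed homomorphism has zero coboundary. [cite: SerreGaloisCohomology1997, I §5.1 (cocycles, crossed homomorphisms)] -/
theorem cobd_eq_zero_of_isCrossedHom {κ : G → M} (hκ : D.IsCrossedHom κ) (g h : G) : D.cobd κ g h = 0 := by
  rw [cobd_apply, hκ g h]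
  abel

/-- The coboundary is additive in the cochain. [cite: SerreGaloisCohomology1997, I §5.1 (cocycles, crossed homomorphisms)] -/
theorem cobd_add (β γ : G → M) (g h : G) : D.cobd (β + γ) g h = D.cobd β g h + D.cobd γ g h := by
  simp only [cobd_apply, Pi.add_apply, map_add]
  abel

/-- **`d ∘ d = 0`**: the coboundary of a `1`-cochain satisfies the `2`-cocycle identity
`σ dβ(τ,υ) + dβ(σ,τυ) = dβ(στ,υ) + dβ(σ,τ)` (the tree's `contTwoCocycles` convention). [cite: SerreGaloisCohomology1997, I §5.1 (cocycles, crossed homomorphisms)] -/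
theorem cobd_cocycle (β : G → M) (g h k : G) :
    D.ρ g (D.cobd β h k) + D.cobd β g (h * k) = D.cobd β (g * h) k + D.cobd β g h := by
  simp only [cobd_apply, map_add, map_sub, map_mul, AddMonoid.End.coe_mul, Function.comp_apply, mul_assoc]
  abel

/-! ### Translation by central elements -/

/-- **Translation by a central element**: `cadd a w = inl(a) · w = w · inl(a)`, i.e. `(a + w.a, w.x)` — a
normal form for products containing central factors. [cite: Brown1982, Ch. IV §3 (extensions defined by a 2-cocycle)] -/
def cadd (a : A) (w : D.Ext) : D.Ext := ⟨a + w.a, w.x⟩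

/-- `A`-coordinate of `cadd a w`. [cite: Brown1982, Ch. IV §3 (extensions defined by a 2-cocycle)] -/
@[simp] theorem cadd_a (a : A) (w : D.Ext) : (D.cadd a w).a = a + w.a := rfl
/-- `M`-coordinate of `cadd a w`. [cite: Brown1982, Ch. IV §3 (extensions defined by a 2-cocycle)] -/
@[simp] theorem cadd_x (a : A) (w : D.Ext) : (D.cadd a w).x = w.x := rfl

/-- `inl a · w = cadd a w`. [cite: Brown1982, Ch. IV §3 (extensions defined by a 2-cocycle)] -/
theorem inl_mul_eq_cadd (a : A) (w : D.Ext) : D.inl a * w = D.cadd a w := by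
  ext
  · simp only [Ext.mul_a, inl_a, inl_x, cadd_a, D.m_zero_left, add_zero]
  · simp only [Ext.mul_x, inl_x, cadd_x, zero_add]

/-- `w · inl a = cadd a w` (centrality). [cite: Brown1982, Ch. IV §3 (extensions defined by a 2-cocycle)] -/
theorem mul_inl_eq_cadd (w : D.Ext) (a : A) : w * D.inl a = D.cadd a w := by
  rw [← inl_mul_comm, inl_mul_eq_cadd]

/-- `cadd a w · w' = cadd a (w · w')`. [cite: Brown1982, Ch. IV §3 (extensions defined by a 2-cocycle)] -/
theorem cadd_mul (a : A) (w w' : D.Ext) : D.cadd a w * w' = D.cadd a (w * w') := by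
  rw [← inl_mul_eq_cadd, ← inl_mul_eq_cadd, mul_assoc]

/-- `w · cadd a w' = cadd a (w · w')`. [cite: Brown1982, Ch. IV §3 (extensions defined by a 2-cocycle)] -/
theorem mul_cadd (w : D.Ext) (a : A) (w' : D.Ext) : w * D.cadd a w' = D.cadd a (w * w') := by
  rw [← inl_mul_eq_cadd, ← inl_mul_eq_cadd, ← mul_assoc, ← inl_mul_comm, mul_assoc]

/-- `cadd a (cadd b w) = cadd (a + b) w`. [cite: Brown1982, Ch. IV §3 (extensions defined by a 2-cocycle)] -/
theorem cadd_cadd (a b : A) (w : D.Ext) : D.cadd a (D.cadd b w) = D.cadd (a + b) w := by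
  ext
  · simp only [cadd_a, add_assoc]
  · simp only [cadd_x]

/-- `σ(cadd a w) = cadd (σa) (σw)`. [cite: SerreGaloisCohomology1997, I §5.7 (connecting map of a central extension of G-groups)] -/
theorem act_cadd (g : G) (a : A) (w : D.Ext) : D.act g (D.cadd a w) = D.cadd (D.α g a) (D.act g w) := by
  ext
  · simp only [act_apply_a, cadd_a, cadd_x, map_add, add_assoc]
  · simp only [act_apply_x, cadd_x]

/-- `cadd a w = cadd b w` forces `a = b`. [cite: Brown1982, Ch. IV §3 (extensions defined by a 2-cocycle)] -/
theorem cadd_left_cancel {a b : A} {w : D.Ext} (h : D.cadd a w = D.cadd b w) : a = b := by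
  have h' := congrArg Ext.a h
  simp only [cadd_a] at h'
  exact add_right_cancel h'

/-- The commutation rule in `cadd` form: `u · v = cadd (e(u.x, v.x)) (v · u)`. [cite: PoonenRains2012, Prop. 4.5 (c) (commutator pairing of the Heisenberg group)] -/
theorem mul_eq_cadd_commForm_mul (u v : D.Ext) : u * v = D.cadd (D.commForm u.x v.x) (v * u) := by
  rw [← inl_mul_eq_cadd]
  exact mul_eq_inl_commForm_mul D u v

/-- `s(ξ_σ)·σ s(ξ_τ) = cadd (conn ξ (σ,τ)) (s(ξ_{στ}))` for a crossed homomorphism (`sec_mul_act_sec` in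
`cadd` form). [cite: SerreGaloisCohomology1997, I §5.7 (connecting map of a central extension of G-groups)] -/
theorem sec_mul_act_sec_eq_cadd {ξ : G → M} (hξ : D.IsCrossedHom ξ) (g h : G) :
    D.sec (ξ g) * D.act g (D.sec (ξ h)) = D.cadd (D.conn ξ g h) (D.sec (ξ (g * h))) := by
  rw [sec_mul_act_sec D hξ, inl_mul_eq_cadd]

/-! ### Level structures -/

/-- A **level structure** on a Heisenberg datum: a `G`-stable subgroup `M₀ ≤ M` and `λ : M → A` such that
`t(x) = (λ x, x)` restricts to a `G`-equivariant homomorphism `M₀ → V` — a homomorphic equivariant section of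
the extension over `M₀`, i.e. a trivialisation of the Poonen–Stoll class of Morgan–Smith Def. 5.7 (only the
values of `λ` on `M₀` matter). [cite: MorganSmith2021CTP, §5 Def. 5.7 (the section s and the Poonen–Stoll class)] -/
structure LevelStructure (D : HeisenbergDatum G M A) where
  /-- the sub-object `M₀` over which the extension is trivialised -/
  M₀ : AddSubgroup M
  /-- `M₀` is `G`-stable -/
  smul_mem : ∀ (g : G) {x : M}, x ∈ M₀ → D.ρ g x ∈ M₀
  /-- the correction `λ` of the section on `M₀` -/
  lam : M → A
  /-- `t` is a homomorphism on `M₀`: `m(x,y) + λ x + λ y = λ (x + y)` -/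
  m_add_lam : ∀ {x y : M}, x ∈ M₀ → y ∈ M₀ → D.m x y + lam x + lam y = lam (x + y)
  /-- `t` is equivariant on `M₀`: `χ_σ(x) + σ λ(x) = λ(σ x)` -/
  χ_add_lam : ∀ (g : G) {x : M}, x ∈ M₀ → D.χ g x + D.α g (lam x) = lam (D.ρ g x)

namespace LevelStructure

variable {D} (L : D.LevelStructure)

/-- `λ 0 = 0`. [cite: MorganSmith2021CTP, §5 Def. 5.7 (the section s and the Poonen–Stoll class)] -/
theorem lam_zero : L.lam 0 = 0 := by
  have h := L.m_add_lam L.M₀.zero_mem L.M₀.zero_mem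
  rw [D.m_zero_left, zero_add, add_zero] at h
  have h' : L.lam 0 + L.lam 0 - L.lam 0 = 0 := by rw [h]; exact sub_self _
  rwa [add_sub_cancel_left] at h'

/-- **The homomorphic section** `t(x) = (λ x, x) ∈ V` (Morgan–Smith's `s`). [cite: MorganSmith2021CTP, §5 Def. 5.7 (the section s and the Poonen–Stoll class)] -/
def lift (x : M) : D.Ext := ⟨L.lam x, x⟩

/-- `A`-coordinate of `t x`. [cite: MorganSmith2021CTP, §5 Def. 5.7 (the section s and the Poonen–Stoll class)] -/
@[simp] theorem lift_a (x : M) : (L.lift x).a = L.lam x := rfl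
/-- `M`-coordinate of `t x`. [cite: MorganSmith2021CTP, §5 Def. 5.7 (the section s and the Poonen–Stoll class)] -/
@[simp] theorem lift_x (x : M) : (L.lift x).x = x := rfl

/-- `t x = cadd (λ x) (s x)`. [cite: MorganSmith2021CTP, §5 Def. 5.7 (the section s and the Poonen–Stoll class)] -/
theorem lift_eq (x : M) : L.lift x = D.cadd (L.lam x) (D.sec x) := by
  ext
  · simp only [lift_a, cadd_a, sec_a, add_zero]
  · simp only [lift_x, cadd_x, sec_x]

/-- **`t` is additive on `M₀`**: `t x · t y = t (x + y)`. [cite: MorganSmith2021CTP, §5 Def. 5.7 (the section s and the Poonen–Stoll class)] -/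
theorem lift_mul_lift {x y : M} (hx : x ∈ L.M₀) (hy : y ∈ L.M₀) : L.lift x * L.lift y = L.lift (x + y) := by
  ext
  · simp only [Ext.mul_a, lift_a, lift_x]
    linear_combination (norm := abel) L.m_add_lam hx hy
  · simp only [Ext.mul_x, lift_x]

/-- **`t` is equivariant on `M₀`**: `σ(t x) = t(σ x)`. [cite: MorganSmith2021CTP, §5 Def. 5.7 (the section s and the Poonen–Stoll class)] -/
theorem act_lift (g : G) {x : M} (hx : x ∈ L.M₀) : D.act g (L.lift x) = L.lift (D.ρ g x) := by
  ext
  · simp only [act_apply_a, lift_a, lift_x]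
    rw [add_comm]
    exact L.χ_add_lam g hx
  · simp only [act_apply_x, lift_x]

/-- The commutation rule of `V` against `t`: `u · t z = cadd (e(u.x, z)) (t z · u)`. [cite: MorganSmith2021CTP, §5 Def. 5.1 (the associated commutator pairing)] -/
theorem mul_lift (u : D.Ext) (z : M) : u * L.lift z = D.cadd (D.commForm u.x z) (L.lift z * u) := by
  have h := D.mul_eq_cadd_commForm_mul u (L.lift z)
  rwa [lift_x] at h

/-- **`M₀` is isotropic** for the commutator form: `e(x, y) = 0` for `x, y ∈ M₀` (the extension is
commutative over `M₀`; Morgan–Smith Assumption 5.5 (1)). [cite: MorganSmith2021CTP, §5 Assumption 5.5 and Remark 5.6] -/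
theorem commForm_eq_zero {x y : M} (hx : x ∈ L.M₀) (hy : y ∈ L.M₀) : D.commForm x y = 0 := by
  rw [commForm_apply]
  have h1 := L.m_add_lam hx hy
  have h2 := L.m_add_lam hy hx
  rw [add_comm y x] at h2
  linear_combination (norm := abel) h1 - h2

/-- `s(y + x) = cadd (−(λ x + m(y, x))) (s(y) · t(x))`: factorisation of the section of a sum through `t`.
[cite: MorganSmith2021CTP, §5 Lemma 5.14 (products of lifts)] -/
theorem sec_add_eq (y x : M) : D.sec (y + x) = D.cadd (-(L.lam x + D.m y x)) (D.sec y * L.lift x) := by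
  ext
  · simp only [Ext.mul_a, sec_a, sec_x, cadd_a, lift_a, lift_x, zero_add]
    abel
  · simp only [Ext.mul_x, sec_x, cadd_x, lift_x]

/-! ### The level connecting cochain -/

/-- **The level connecting cochain** of a `1`-cochain `β` (meaningful when `dβ` is `M₀`-valued):
`lconn β (σ,τ) = χ_σ(β_τ) + m(β_σ, σβ_τ) − m(dβ(σ,τ), β_{στ}) − λ(dβ(σ,τ))` — Morgan–Smith's
`A`-valued `2`-cochain `db − s ∘ A₁` for the lift `b = s ∘ β`. [cite: MorganSmith2021CTP, §5 Prop. 5.16 (the cochain db − s∘A₁)] -/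
def lconn (β : G → M) (g h : G) : A :=
  D.χ g (β h) + D.m (β g) (D.ρ g (β h)) - D.m (D.cobd β g h) (β (g * h)) - L.lam (D.cobd β g h)

/-- Unfolding `lconn`. [cite: MorganSmith2021CTP, §5 Prop. 5.16 (the cochain db − s∘A₁)] -/
theorem lconn_apply (β : G → M) (g h : G) :
    L.lconn β g h = D.χ g (β h) + D.m (β g) (D.ρ g (β h)) - D.m (D.cobd β g h) (β (g * h)) - L.lam (D.cobd β g h) :=
  rfl

/-- `lconn β = conn β − (m(dβ, β_{στ}) + λ(dβ))`. [cite: MorganSmith2021CTP, §5 Prop. 5.16 (the cochain db − s∘A₁)] -/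
theorem lconn_eq_conn_sub (β : G → M) (g h : G) :
    L.lconn β g h = D.conn β g h - (D.m (D.cobd β g h) (β (g * h)) + L.lam (D.cobd β g h)) := by
  rw [lconn_apply, conn_apply]
  abel

/-- For a crossed homomorphism the level connecting cochain IS the connecting cochain: `lconn κ = conn κ`.
[cite: MorganSmith2021CTP, §5 Prop. 5.16 (the cochain db − s∘A₁)] -/
theorem lconn_eq_conn {κ : G → M} (hκ : D.IsCrossedHom κ) (g h : G) : L.lconn κ g h = D.conn κ g h := by
  rw [lconn_eq_conn_sub, D.cobd_eq_zero_of_isCrossedHom hκ, D.m_zero_left, L.lam_zero, add_zero, sub_zero]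

/-- **The defining factorisation** `s(β_σ) · σ s(β_τ) = cadd (lconn β (σ,τ)) (t(dβ(σ,τ)) · s(β_{στ}))` in `V`
(unconditionally; Morgan–Smith: `db = (db − s∘A₁) + s∘A₁`). [cite: MorganSmith2021CTP, §5 Prop. 5.16 (the cochain db − s∘A₁)] -/
theorem sec_mul_act_sec_eq (β : G → M) (g h : G) :
    D.sec (β g) * D.act g (D.sec (β h)) = D.cadd (L.lconn β g h) (L.lift (D.cobd β g h) * D.sec (β (g * h))) := by
  ext
  · simp only [Ext.mul_a, sec_a, sec_x, act_apply_a, act_apply_x, cadd_a, lift_a, lift_x, lconn_apply,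
      map_zero, zero_add]
    abel
  · simp only [Ext.mul_x, sec_x, act_apply_x, cadd_x, lift_x, cobd_apply]
    abel

/-- **`d(lconn β) = −β ∪ₑ dβ`** when `dβ` is `M₀`-valued (Morgan–Smith Lemma 5.12 + Lemma 5.15 with `ψ_PS = 0`,
their Prop. 5.16 (1)): `σ·c(τ,υ) + c(σ,τυ) + e(β_σ, σ dβ(τ,υ)) = c(στ,υ) + c(σ,τ)`, i.e. in the tree's
conventions `dc = B` with `B(σ,τ,υ) = −e(β_σ, σ dβ(τ,υ))`, the cup product `−(β ∪ dβ)`.  Proof: evaluate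
`s(β_σ)·σ s(β_τ)·στ s(β_υ)` in `V` in two ways. [cite: MorganSmith2021CTP, §5 Lemma 5.12 and Prop. 5.16 (1)] -/
theorem lconn_cocycle {β : G → M} (hβ : ∀ g h, D.cobd β g h ∈ L.M₀) (g h k : G) :
    D.α g (L.lconn β h k) + L.lconn β g (h * k) + D.commForm (β g) (D.ρ g (D.cobd β h k)) =
      L.lconn β (g * h) k + L.lconn β g h := by
  have hi : ∀ σ τ, D.sec (β σ) * D.act σ (D.sec (β τ)) =
      D.cadd (L.lconn β σ τ) (L.lift (D.cobd β σ τ) * D.sec (β (σ * τ))) := fun σ τ =>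
    L.sec_mul_act_sec_eq β σ τ
  -- way 1: associate to the left
  have e1 : D.sec (β g) * D.act g (D.sec (β h)) * D.act (g * h) (D.sec (β k)) =
      D.cadd (L.lconn β g h + L.lconn β (g * h) k)
        (L.lift (D.cobd β g h + D.cobd β (g * h) k) * D.sec (β (g * h * k))) := by
    rw [hi g h, D.cadd_mul, mul_assoc, hi (g * h) k, D.mul_cadd, D.cadd_cadd, ← mul_assoc,
      L.lift_mul_lift (hβ g h) (hβ (g * h) k)]
  -- way 2: associate to the right
  have e2 : D.sec (β g) * D.act g (D.sec (β h)) * D.act (g * h) (D.sec (β k)) =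
      D.cadd (D.α g (L.lconn β h k) + (D.commForm (β g) (D.ρ g (D.cobd β h k)) + L.lconn β g (h * k)))
        (L.lift (D.ρ g (D.cobd β h k) + D.cobd β g (h * k)) * D.sec (β (g * (h * k)))) := by
    have hconj : D.sec (β g) * L.lift (D.ρ g (D.cobd β h k)) =
        D.cadd (D.commForm (β g) (D.ρ g (D.cobd β h k))) (L.lift (D.ρ g (D.cobd β h k)) * D.sec (β g)) := by
      have := L.mul_lift (D.sec (β g)) (D.ρ g (D.cobd β h k))
      rwa [sec_x] at this
    rw [mul_assoc, act_mul, ← map_mul, hi h k, D.act_cadd, map_mul, L.act_lift g (hβ h k), D.mul_cadd,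
      ← mul_assoc, hconj, D.cadd_mul, D.cadd_cadd, mul_assoc, hi g (h * k), D.mul_cadd, D.cadd_cadd,
      ← mul_assoc, L.lift_mul_lift (L.smul_mem g (hβ h k)) (hβ g (h * k)), add_assoc]
  -- compare
  rw [D.cobd_cocycle β g h k, ← mul_assoc g h k, add_comm (D.cobd β (g * h) k)] at e2
  have key := D.cadd_left_cancel (e2.symm.trans e1)
  linear_combination (norm := abel) key

/-- **The level connecting cochain of `κ + γ`** for a crossed homomorphism `κ` and an `M₀`-valued cochain `γ`
(Morgan–Smith Lemma 5.14 / Prop. 5.16 (2)): with `μ(σ) = −(λ(γ_σ) + m(κ_σ, γ_σ))`,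
`lconn (κ+γ)(σ,τ) = conn κ (σ,τ) + e(γ_σ, σκ_τ) + e(κ_{στ}, dγ(σ,τ)) + (σμ(τ) − μ(στ) + μ(σ))`.
Proof: factor the lifts `s(κ_σ + γ_σ) = cadd μ_σ (s(κ_σ)·t(γ_σ))` and compute `s(β_σ)·σ s(β_τ)` twice.
[cite: MorganSmith2021CTP, §5 Lemma 5.14 and Prop. 5.16 (2)] -/
theorem lconn_add_of_isCrossedHom {κ γ : G → M} (hκ : D.IsCrossedHom κ) (hγ : ∀ g, γ g ∈ L.M₀) (g h : G) :
    L.lconn (κ + γ) g h = D.conn κ g h + D.commForm (γ g) (D.ρ g (κ h)) +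
      D.commForm (κ (g * h)) (D.cobd γ g h) +
      (D.α g (-(L.lam (γ h) + D.m (κ h) (γ h))) - (-(L.lam (γ (g * h)) + D.m (κ (g * h)) (γ (g * h)))) +
        (-(L.lam (γ g) + D.m (κ g) (γ g)))) := by
  have hfac : ∀ σ, D.sec ((κ + γ) σ) = D.cadd (-(L.lam (γ σ) + D.m (κ σ) (γ σ))) (D.sec (κ σ) * L.lift (γ σ)) :=
    fun σ => L.sec_add_eq (κ σ) (γ σ)
  -- the coboundary of `κ + γ` is that of `γ`, and is `M₀`-valued
  have hF : D.cobd (κ + γ) g h = D.cobd γ g h := by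
    rw [D.cobd_add, D.cobd_eq_zero_of_isCrossedHom hκ, zero_add]
  have hFmem : D.cobd γ g h ∈ L.M₀ := by
    rw [cobd_apply]
    exact L.M₀.add_mem (L.M₀.sub_mem (L.smul_mem g (hγ h)) (hγ (g * h))) (hγ g)
  -- `γ_σ + σγ_τ = dγ(σ,τ) + γ_{στ}`
  have hsum : γ g + D.ρ g (γ h) = D.cobd γ g h + γ (g * h) := by rw [cobd_apply]; abel
  -- the two commutations used
  have hc1 : L.lift (γ g) * D.sec (D.ρ g (κ h)) =
      D.cadd (D.commForm (γ g) (D.ρ g (κ h))) (D.sec (D.ρ g (κ h)) * L.lift (γ g)) := by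
    have := D.mul_eq_cadd_commForm_mul (L.lift (γ g)) (D.sec (D.ρ g (κ h)))
    rwa [lift_x, sec_x] at this
  have hc2 : D.sec (κ (g * h)) * L.lift (D.cobd γ g h) =
      D.cadd (D.commForm (κ (g * h)) (D.cobd γ g h)) (L.lift (D.cobd γ g h) * D.sec (κ (g * h))) := by
    have := L.mul_lift (D.sec (κ (g * h))) (D.cobd γ g h)
    rwa [sec_x] at this
  -- way 1: through the factorisation of the lifts (normal form `cadd (…) (t(dγ) · (s(κ_{στ}) · t(γ_{στ})))`)
  have e1 : D.sec ((κ + γ) g) * D.act g (D.sec ((κ + γ) h)) = D.sec ((κ + γ) g) * D.act g (D.sec ((κ + γ) h)) := rfl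
  conv at e1 =>
    rhs
    rw [hfac g, hfac h, D.act_cadd, map_mul, L.act_lift g (hγ h), act_sec, D.inl_mul_eq_cadd]
    simp only [D.cadd_mul, D.mul_cadd, D.cadd_cadd]
    rw [← mul_assoc (D.sec (κ g) * L.lift (γ g)), mul_assoc (D.sec (κ g)) (L.lift (γ g)), hc1]
    simp only [D.cadd_mul, D.mul_cadd, D.cadd_cadd]
    rw [← mul_assoc (D.sec (κ g)) (D.sec _) (L.lift (γ g)), mul_assoc _ (L.lift (γ g)) (L.lift _), sec_mul_sec,
      D.inl_mul_eq_cadd, ← hκ g h, L.lift_mul_lift (hγ g) (L.smul_mem g (hγ h)), hsum,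
      ← L.lift_mul_lift hFmem (hγ (g * h))]
    simp only [D.cadd_mul, D.mul_cadd, D.cadd_cadd]
    rw [← mul_assoc (D.sec (κ (g * h))), hc2]
    simp only [D.cadd_mul, D.mul_cadd, D.cadd_cadd]
    rw [mul_assoc]
  -- way 2: through the defining factorisation of `lconn`
  have e2 : D.sec ((κ + γ) g) * D.act g (D.sec ((κ + γ) h)) =
      D.cadd (L.lconn (κ + γ) g h + -(L.lam (γ (g * h)) + D.m (κ (g * h)) (γ (g * h))))
        (L.lift (D.cobd γ g h) * (D.sec (κ (g * h)) * L.lift (γ (g * h)))) := by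
    rw [L.sec_mul_act_sec_eq (κ + γ) g h, hF, hfac (g * h), D.mul_cadd, D.cadd_cadd]
  have key := D.cadd_left_cancel (e2.symm.trans e1)
  rw [conn_apply]
  linear_combination (norm := abel) key

/-! ### Pull-back along a monoid homomorphism -/

/-- **Pull-back of a level structure** along `φ : H →* G` (to the datum `D.comap φ`): same `M₀`, same `λ`.
[cite: SerreGaloisCohomology1997, I §2.4 and I §5.8 (compatible pairs, functoriality)] -/
def comap {H : Type*} [Monoid H] (φ : H →* G) : (D.comap φ).LevelStructure where
  M₀ := L.M₀
  smul_mem h _ hx := L.smul_mem (φ h) hx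
  lam := L.lam
  m_add_lam hx hy := L.m_add_lam hx hy
  χ_add_lam h _ hx := L.χ_add_lam (φ h) hx

/-- The sub-object of the pulled-back level structure. [cite: SerreGaloisCohomology1997, I §2.4 and I §5.8 (compatible pairs, functoriality)] -/
@[simp] theorem comap_M₀ {H : Type*} [Monoid H] (φ : H →* G) : (L.comap φ).M₀ = L.M₀ := rfl

/-- The correction function of the pulled-back level structure. [cite: SerreGaloisCohomology1997, I §2.4 and I §5.8 (compatible pairs, functoriality)] -/
@[simp] theorem comap_lam {H : Type*} [Monoid H] (φ : H →* G) : (L.comap φ).lam = L.lam := rfl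

/-- The coboundary of a pulled-back cochain is the pulled-back coboundary. [cite: SerreGaloisCohomology1997, I §2.4 and I §5.8 (compatible pairs, functoriality)] -/
theorem _root_.Literature.Algebra.Homology.HeisenbergDatum.cobd_comp {H : Type*} [Monoid H] (φ : H →* G)
    (β : G → M) (g h : H) : (D.comap φ).cobd (β ∘ φ) g h = D.cobd β (φ g) (φ h) := by
  simp only [cobd_apply, comap_ρ_apply, Function.comp_apply, map_mul]

/-- `lconn` commutes with pull-back: `lconn (β ∘ φ) = lconn β ∘ (φ × φ)`. [cite: SerreGaloisCohomology1997, I §2.4 and I §5.8 (compatible pairs, functoriality)] -/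
theorem lconn_comp {H : Type*} [Monoid H] (φ : H →* G) (β : G → M) (g h : H) :
    (L.comap φ).lconn (β ∘ φ) g h = L.lconn β (φ g) (φ h) := by
  simp only [lconn_apply, D.cobd_comp, comap_ρ_apply, comap_χ, comap_m, comap_lam, Function.comp_apply, map_mul]

end LevelStructure

end HeisenbergDatum

end Literature.Algebra.Homology
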